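import Summits.QuantumFields.BalabanUV.T4Continuum.Support.ShellMeasureLandauHolonomy

/-!
# `T4Continuum.ShellMeasureLandauPinnedFixedPoint` — THE LD CHAIN'S FIXED POINTS READ IN A SECOND NORM (file 1 of 2):
# the variation of the scheme's solution `solAt` and of the Landau correction `corrAt` ∕ exponent `landauExp` in a
# PINNED reading, from DISPLAYED pinned Lipschitz∕operator binders; and how such binders are produced
(cell `pub-balaban`, sub-cell `t4`, spine estimate NE7c (node U5b); NE7c formalisation swarm, crew seat
`b2b-balaban-t4-ne7c-formalise-leaf-07` gen 6 — companion «f2: fixed point pinned» of row S70 «END-II-loc: THE LD CHAIN IN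
TWO NORMS» of `t4/b2b-balaban-t4-ne7c-p1/LEAVES-NE7c-P1.md` (holder lineage `…-leaf-01`, invitation journal l.16173, claim
l.16311); imports `ShellMeasureLandauHolonomy` (LD: `solAt`, `corrAt`, `landauExp`; hence `B11Prop6Scheme`,
`B13Contraction113`, `ShellMeasureLandauFixedPoint`) ONLY; [folklore]; 0 `def`, 0 `def … : Prop`, 0 sorry, 0 citation;
file 2 = `ShellMeasureLandauPinnedField` (the exponent field `Z_V` on the chart ball, S70 (iv)))

HONEST FRAMING.  Finite four-torus programme, rung (B)+1 only — NOT infinite volume, NOT a mass gap, NOT the Clay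
problem, NOT summit progress; (B), `BetaPertHyp`, (B^μ) not consumed.  NE7c (`T4IndicatorShell.ShellWeightBound`) is
NOT PRINTED in [Balaban 1983–89] and NOT PROVED; «NE7c ⇐ the named binders» (trigger c3).  Nothing printed is asserted
here; no estimate of Bałaban's is discharged.  This file is a-priori fixed-point perturbation ALGEBRA on OUR side.

THE LOCALITY ROAD (owner finding F-ne7cp1-g30-1, rows S69–S71).  END-II of record reads the exponent field
`Z_V(y) = landauExp Cf ι H r (solAt 𝒢 0 W𝒱 ε₄ 0 (H₁ Φ(cplx y)) + H₁ Φ(cplx y))` along the chart ray in the FLAT sup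
norm, so every plaquette letter pays the p-UNIFORM cost `z̄` and the slot constant is volume-extensive at live levels.
Row S70 re-reads the VARIATION `Z_V(y) − Z_V(0)` in S69's PINNED norm (`ShellMeasurePinnedNorm`: `WSup (pinW δ′ ϖ) 1`),
in which far letters see the decay `e^{−δ′ϖ}`.  Its item (iii) asks for «`solAt` as a contraction in the pinned norm».
THE HONEST FORM OF (iii), proved here: NO second Banach iteration is run — existence and uniqueness of the scheme's
solution and of the Landau correction stay FLAT (B11 Prop. 6's scheme, Sect. C's scheme, by name); what is pinned is the
A-PRIORI ESTIMATE «two fixed points of two `q`-contractions (read through `π`) that differ by `η` at one of them are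
`η∕(1−q)`-close (read through `π`)», with the pinned contraction numbers DISPLAYED as binders.

THE READINGS.  Every space of the LD chain (`𝒴` configurations, `𝒴′` the scaled ones, `𝒳` where `C` acts) is read
through an arbitrary continuous linear map `π𝒴 : 𝒴 →L[ℂ] P𝒴`, … into an arbitrary normed space — to be INSTANTIATED by
the S70 holder with the identity into S69's pinned space read through S65 f2a's `WSup.toPiL`; every pinned input is a
Lipschitz∕operator binder in that currency (trigger c2: no `def … : Prop`):
* `hΛp : ‖π(Λ Y)‖ ≤ θₚ‖π Y‖`, `hGWp : ‖π(𝒢 (W Y)) − π(𝒢 (W Y′))‖ ≤ q_W‖π Y − π Y′‖` on the flat ball `‖·‖ < ε₄ + a`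
  (S70 f1's item (ii) for `𝒢 ∘ D(W𝒱)` as a decaying-kernel operator + the mean value inequality — §4 is that step);
* `hCp : ‖π𝒳(C A) − π𝒳(C A′)‖ ≤ L_C‖π𝒴′ A − π𝒴′ A′‖` on the flat ball `‖·‖ < R` (leaf-08's `DCf` companion over S67's
  (73)-TYPE decay, by SHAPE), `hιp : ‖π𝒴′(ι Y)‖ ≤ c_ι‖π𝒴 Y‖`, `hHp : ‖π𝒴(H X)‖ ≤ B_H‖π𝒳 X‖` ((46)∕(3.133) decay TYPE).

WHAT IS PROVED ([folklore]).
* §1 `norm_sub_le_of_fixedPoints` — two fixed points read in a second norm: `x = T x`, `x′ = T′ x′`,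
  `‖π(T x) − π(T x′)‖ ≤ q‖π x − π x′‖`, `‖π(T x′) − π(T′ x′)‖ ≤ η`, `q < 1` ⟹ `‖π x − π x′‖ ≤ η∕(1 − q)`.
* §2 THE SCHEME (`B11Prop6Scheme.mapT`): `norm_sub_le_of_mapT_fixedPoints` — for flat fixed points `X`, `X′` at data
  `𝔄`, `𝔄′` (`‖X‖, ‖X′‖ ≤ ε₄`, `‖𝔄‖, ‖𝔄′‖ < a`) and `s := θₚ + q_W < 1`:
  `‖π X − π X′‖ ≤ s∕(1−s)·‖π 𝔄 − π 𝔄′‖`, `‖π(X + 𝔄) − π(X′ + 𝔄′)‖ ≤ 1∕(1−s)·‖π 𝔄 − π 𝔄′‖`; `norm_sub_solAt_le` — the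
  same for `solAt` under the FLAT hypotheses of `ShellMeasureLandauHolonomy.solAt_along` VERBATIM ((P2) `h𝒢`∕`hΛ`, (P4)
  `hW`, (118)∕(121)); `solAt_zero_zero` — `solAt 𝒢 Λ W ε₄ 0 0 = 0`.
* §3 THE LANDAU CORRECTION (`corrAt`, Sect. C (50)): `norm_sub_le_of_corr_fixedPoints`, `norm_sub_corrAt_le` — under
  Sect. C's flat list VERBATIM (`hCq`∕`hCd`, `hι`, `hH`, `9C₂B₀ε < 1`, `3ε ≤ R`) and `k := L_C·c_ι·B_H < 1`, for
  `‖Y‖, ‖Y′‖ < ε`: `‖π𝒳 D(Y) − π𝒳 D(Y′)‖ ≤ L_C c_ι∕(1−k)·‖π𝒴 Y − π𝒴 Y′‖` and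
  `‖π𝒴(landauExp … Y) − π𝒴(landauExp … Y′)‖ ≤ 1∕(1−k)·‖π𝒴 Y − π𝒴 Y′‖`; `corrAt_zero`, `landauExp_zero`.
* §4 HOW A PINNED LIPSCHITZ BINDER IS PRODUCED: `norm_sub_le_of_conj_fderiv_le` — readings that are continuous linear
  EQUIVALENCES (the identity in another norm, finite lattice), a flat open convex set, and a bound `q` on the CONJUGATED
  derivative `e_F ∘L DG(x) ∘L e_E⁻¹` (S69 (A) `ShellMeasurePinnedNorm.opNorm_kerOpPin_le` supplies it for decaying
  kernels) ⟹ `‖e_F(G x) − e_F(G y)‖ ≤ q·‖e_E x − e_E y‖` (Mathlib's `Convex.norm_image_sub_le_of_norm_fderiv_le` run in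
  the pinned space on the conjugated map over the conjugated set).
NOTHING in the countdown moves; NE7c NOT PROVED; spine PROVED 0∕9.  HONEST DEPENDENCY (cell): continuum YM on T⁴ ⇐
BetaPertH ∧ nine spine estimates (0/9 proved); BetaPertH ⇐ (D1) ∧ (D4) ∧ CAP+tail; G-an2-4 gates asym, D1 and NE2/3/4.
-/
noncomputable section

open Set Metric

namespace Summit.QuantumFields.BalabanUV.T4Continuum.ShellMeasureLandauPinnedFixedPoint

open Literature.MathematicalPhysics.QuantumFieldTheory.Balaban1983to89
open B11Prop6Scheme (mapT Prop4Hyp norm_arg_lt existsUnique_solution)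
open B13Contraction113 (exists_unique_fixedPoint)
open ShellMeasureLandauFixedPoint (quadAnalytic_of_frechet)
open ShellMeasureLandauHolonomy (solAt corrAt landauExp solAt_spec solAt_along corrAt_spec corrAt_along
  landauExp_apply)

variable {𝒴 𝒴' 𝒳 𝒵 : Type*} [NormedAddCommGroup 𝒴] [NormedSpace ℂ 𝒴] [NormedAddCommGroup 𝒴'] [NormedSpace ℂ 𝒴']
  [NormedAddCommGroup 𝒳] [NormedSpace ℂ 𝒳] [NormedAddCommGroup 𝒵] [NormedSpace ℂ 𝒵]
variable {P𝒴 P𝒴' P𝒳 : Type*} [NormedAddCommGroup P𝒴] [NormedSpace ℂ P𝒴] [NormedAddCommGroup P𝒴']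
  [NormedSpace ℂ P𝒴'] [NormedAddCommGroup P𝒳] [NormedSpace ℂ P𝒳]

/-! ## §1 Two fixed points read in a second norm -/

/-- **TWO FIXED POINTS READ IN A SECOND NORM.**  `x = T x`, `x′ = T′ x′`; read through `π`, `T` contracts the pair with
`q < 1` and `T`, `T′` differ by `η` at `x′` ⟹ `‖π x − π x′‖ ≤ η∕(1 − q)`.  (No completeness, no iteration: the fixed
points are GIVEN.) [folklore] -/
theorem norm_sub_le_of_fixedPoints {E PE : Type*} [NormedAddCommGroup E] [NormedSpace ℂ E]
    [NormedAddCommGroup PE] [NormedSpace ℂ PE] (π : E →L[ℂ] PE) {T T' : E → E} {x x' : E}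
    (hx : T x = x) (hx' : T' x' = x') {q η : ℝ} (hq : q < 1)
    (hcontr : ‖π (T x) - π (T x')‖ ≤ q * ‖π x - π x'‖) (hη : ‖π (T x') - π (T' x')‖ ≤ η) :
    ‖π x - π x'‖ ≤ η / (1 - q) := by
  rw [le_div_iff₀ (by linarith)]
  have h : ‖π x - π x'‖ ≤ q * ‖π x - π x'‖ + η :=
    calc ‖π x - π x'‖ = ‖(π (T x) - π (T x')) + (π (T x') - π (T' x'))‖ := by
          rw [sub_add_sub_cancel, hx, hx']
      _ ≤ ‖π (T x) - π (T x')‖ + ‖π (T x') - π (T' x')‖ := norm_add_le _ _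
      _ ≤ q * ‖π x - π x'‖ + η := add_le_add hcontr hη
  linarith

/-- the geometric-series arithmetic `k∕(1−k)·t + t = t∕(1−k)·1` behind both perturbation bounds. [folklore] -/
private theorem aux_geom {k t : ℝ} (hk : k < 1) : k / (1 - k) * t + t = 1 / (1 - k) * t := by
  have h : (1 - k) ≠ 0 := (sub_pos.2 hk).ne'
  rw [div_mul_eq_mul_div, div_add' _ _ _ h, one_div_mul_eq_div]
  congr 1
  ring

/-! ## §2 The scheme's solution read in a second norm -/

section Scheme

variable (π : 𝒴 →L[ℂ] P𝒴) {𝒢 : 𝒵 →L[ℂ] 𝒴} {Λ : 𝒴 →L[ℂ] 𝒴} {W : 𝒴 → 𝒵} {J : 𝒵} {θp qW ε₄ a : ℝ}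

/-- `π (mapT … 𝔄₁ U) − π (mapT … 𝔄₂ V)`: the `J`-terms cancel, the linear term and the nonlinearity separate.
[folklore] -/
private theorem pi_mapT_sub (𝔄₁ 𝔄₂ U V : 𝒴) :
    π (mapT 𝒢 Λ W J 𝔄₁ U) - π (mapT 𝒢 Λ W J 𝔄₂ V) =
      π (Λ ((U + 𝔄₁) - (V + 𝔄₂))) - (π (𝒢 (W (U + 𝔄₁))) - π (𝒢 (W (V + 𝔄₂)))) := by
  simp only [mapT, map_sub, map_add, map_neg]
  abel

/-- **THE SCHEME'S FIXED POINTS READ IN A SECOND NORM.**  Pinned binders: `hΛp` (the linear term), `hGWp` (the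
nonlinearity `Y ↦ 𝒢 (W Y)` is `q_W`-Lipschitz THROUGH `π` on the flat ball `‖Y‖ < ε₄ + a`), `θₚ + q_W < 1`.  For two
FLAT fixed points `X = mapT 𝒢 Λ W J 𝔄 X`, `X′ = mapT 𝒢 Λ W J 𝔄′ X′` with `‖X‖, ‖X′‖ ≤ ε₄`, `‖𝔄‖, ‖𝔄′‖ < a`:
`‖π X − π X′‖ ≤ s∕(1−s)·‖π 𝔄 − π 𝔄′‖` and `‖π(X + 𝔄) − π(X′ + 𝔄′)‖ ≤ 1∕(1−s)·‖π 𝔄 − π 𝔄′‖`, `s = θₚ + q_W`.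
[folklore] -/
theorem norm_sub_le_of_mapT_fixedPoints (hΛp : ∀ Y, ‖π (Λ Y)‖ ≤ θp * ‖π Y‖)
    (hGWp : ∀ Y Y', ‖Y‖ < ε₄ + a → ‖Y'‖ < ε₄ + a →
      ‖π (𝒢 (W Y)) - π (𝒢 (W Y'))‖ ≤ qW * ‖π Y - π Y'‖)
    (hs : θp + qW < 1) {𝔄 𝔄' X X' : 𝒴} (h𝔄 : ‖𝔄‖ < a) (h𝔄' : ‖𝔄'‖ < a) (hX : ‖X‖ ≤ ε₄)
    (hX' : ‖X'‖ ≤ ε₄) (hfix : mapT 𝒢 Λ W J 𝔄 X = X) (hfix' : mapT 𝒢 Λ W J 𝔄' X' = X') :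
    ‖π X - π X'‖ ≤ (θp + qW) / (1 - (θp + qW)) * ‖π 𝔄 - π 𝔄'‖ ∧
      ‖π (X + 𝔄) - π (X' + 𝔄')‖ ≤ 1 / (1 - (θp + qW)) * ‖π 𝔄 - π 𝔄'‖ := by
  have hY : ‖X + 𝔄‖ < ε₄ + a := norm_arg_lt h𝔄 hX
  have hY' : ‖X' + 𝔄'‖ < ε₄ + a := norm_arg_lt h𝔄' hX'
  have hYm : ‖X' + 𝔄‖ < ε₄ + a := norm_arg_lt h𝔄 hX'
  -- the transformation at the datum `𝔄` contracts through `π`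
  have hcontr : ‖π (mapT 𝒢 Λ W J 𝔄 X) - π (mapT 𝒢 Λ W J 𝔄 X')‖ ≤ (θp + qW) * ‖π X - π X'‖ := by
    rw [pi_mapT_sub π]
    have e1 : π ((X + 𝔄) - (X' + 𝔄)) = π X - π X' := by simp only [map_sub, map_add]; abel
    have e2 : π (X + 𝔄) - π (X' + 𝔄) = π X - π X' := by simp only [map_add]; abel
    calc ‖π (Λ ((X + 𝔄) - (X' + 𝔄))) - (π (𝒢 (W (X + 𝔄))) - π (𝒢 (W (X' + 𝔄))))‖
        ≤ ‖π (Λ ((X + 𝔄) - (X' + 𝔄)))‖ + ‖π (𝒢 (W (X + 𝔄))) - π (𝒢 (W (X' + 𝔄)))‖ := norm_sub_le _ _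
      _ ≤ θp * ‖π ((X + 𝔄) - (X' + 𝔄))‖ + qW * ‖π (X + 𝔄) - π (X' + 𝔄)‖ :=
          add_le_add (hΛp _) (hGWp _ _ hY hYm)
      _ = (θp + qW) * ‖π X - π X'‖ := by rw [e1, e2]; ring
  -- the transformations at `𝔄` and `𝔄′` differ by `s·‖π 𝔄 − π 𝔄′‖` at `X′`
  have hη : ‖π (mapT 𝒢 Λ W J 𝔄 X') - π (mapT 𝒢 Λ W J 𝔄' X')‖ ≤ (θp + qW) * ‖π 𝔄 - π 𝔄'‖ := by
    rw [pi_mapT_sub π]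
    have e1 : π ((X' + 𝔄) - (X' + 𝔄')) = π 𝔄 - π 𝔄' := by simp only [map_sub, map_add]; abel
    have e2 : π (X' + 𝔄) - π (X' + 𝔄') = π 𝔄 - π 𝔄' := by simp only [map_add]; abel
    calc ‖π (Λ ((X' + 𝔄) - (X' + 𝔄'))) - (π (𝒢 (W (X' + 𝔄))) - π (𝒢 (W (X' + 𝔄'))))‖
        ≤ ‖π (Λ ((X' + 𝔄) - (X' + 𝔄')))‖ + ‖π (𝒢 (W (X' + 𝔄))) - π (𝒢 (W (X' + 𝔄')))‖ := norm_sub_le _ _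
      _ ≤ θp * ‖π ((X' + 𝔄) - (X' + 𝔄'))‖ + qW * ‖π (X' + 𝔄) - π (X' + 𝔄')‖ :=
          add_le_add (hΛp _) (hGWp _ _ hYm hY')
      _ = (θp + qW) * ‖π 𝔄 - π 𝔄'‖ := by rw [e1, e2]; ring
  have h1 : ‖π X - π X'‖ ≤ (θp + qW) / (1 - (θp + qW)) * ‖π 𝔄 - π 𝔄'‖ := by
    have h := norm_sub_le_of_fixedPoints π hfix hfix' hs hcontr hη
    rwa [mul_div_right_comm] at h
  refine ⟨h1, ?_⟩
  calc ‖π (X + 𝔄) - π (X' + 𝔄')‖ = ‖(π X - π X') + (π 𝔄 - π 𝔄')‖ := by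
        rw [map_add, map_add]; congr 1; abel
    _ ≤ ‖π X - π X'‖ + ‖π 𝔄 - π 𝔄'‖ := norm_add_le _ _
    _ ≤ (θp + qW) / (1 - (θp + qW)) * ‖π 𝔄 - π 𝔄'‖ + ‖π 𝔄 - π 𝔄'‖ := add_le_add h1 le_rfl
    _ = 1 / (1 - (θp + qW)) * ‖π 𝔄 - π 𝔄'‖ := aux_geom hs

variable {B₀ θ C₄ a₃ j : ℝ}

/-- **`solAt` READ IN A SECOND NORM.**  Under the FLAT hypotheses of `ShellMeasureLandauHolonomy.solAt_along` ((P2)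
`h𝒢`∕`hΛ`; (P4) `hW`; the numbers (118)∕(121): `hdom`, `hself`, `hcontr`; `‖J‖ ≤ j`) — so that `solAt` IS the unique
solution in `‖·‖ ≤ ε₄` (`B11Prop6Scheme.existsUnique_solution`) — and the pinned binders of
`norm_sub_le_of_mapT_fixedPoints`: for `‖𝔄‖, ‖𝔄′‖ < a`,
`‖π(solAt … 𝔄) − π(solAt … 𝔄′)‖ ≤ s∕(1−s)·‖π 𝔄 − π 𝔄′‖` and
`‖π(solAt … 𝔄 + 𝔄) − π(solAt … 𝔄′ + 𝔄′)‖ ≤ 1∕(1−s)·‖π 𝔄 − π 𝔄′‖`.  Existence∕uniqueness stay flat; only the a-priori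
variation estimate is pinned. [folklore] -/
theorem norm_sub_solAt_le [CompleteSpace 𝒴] (h𝒢 : ∀ f, ‖𝒢 f‖ ≤ B₀ * ‖f‖) (hΛ : ∀ Y, ‖Λ Y‖ ≤ θ * ‖Y‖)
    (hW : Prop4Hyp W C₄ a₃) (hB₀ : 0 ≤ B₀) (hC₄ : 0 ≤ C₄) (hθ : 0 ≤ θ) (hε₄ : 0 ≤ ε₄)
    (hdom : 2 * (ε₄ + a) ≤ a₃) (hself : B₀ * j + θ * (ε₄ + a) + B₀ * C₄ * (ε₄ + a) ^ 2 ≤ ε₄)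
    (hcontr : θ + 4 * B₀ * C₄ * (ε₄ + a) < 1) (hJ : ‖J‖ ≤ j)
    (hΛp : ∀ Y, ‖π (Λ Y)‖ ≤ θp * ‖π Y‖)
    (hGWp : ∀ Y Y', ‖Y‖ < ε₄ + a → ‖Y'‖ < ε₄ + a →
      ‖π (𝒢 (W Y)) - π (𝒢 (W Y'))‖ ≤ qW * ‖π Y - π Y'‖)
    (hs : θp + qW < 1) {𝔄 𝔄' : 𝒴} (h𝔄 : ‖𝔄‖ < a) (h𝔄' : ‖𝔄'‖ < a) :
    ‖π (solAt 𝒢 Λ W ε₄ J 𝔄) - π (solAt 𝒢 Λ W ε₄ J 𝔄')‖ ≤ (θp + qW) / (1 - (θp + qW)) * ‖π 𝔄 - π 𝔄'‖ ∧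
      ‖π (solAt 𝒢 Λ W ε₄ J 𝔄 + 𝔄) - π (solAt 𝒢 Λ W ε₄ J 𝔄' + 𝔄')‖ ≤
        1 / (1 - (θp + qW)) * ‖π 𝔄 - π 𝔄'‖ := by
  have hsol : ∀ {𝔄₀ : 𝒴}, ‖𝔄₀‖ < a →
      ‖solAt 𝒢 Λ W ε₄ J 𝔄₀‖ ≤ ε₄ ∧ mapT 𝒢 Λ W J 𝔄₀ (solAt 𝒢 Λ W ε₄ J 𝔄₀) = solAt 𝒢 Λ W ε₄ J 𝔄₀ :=
    fun h𝔄₀ => solAt_spec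
      (existsUnique_solution h𝒢 hΛ hW.quadAnalytic hB₀ hC₄ hθ hJ h𝔄₀ hε₄ hdom hself hcontr).exists
  exact norm_sub_le_of_mapT_fixedPoints π hΛp hGWp hs h𝔄 h𝔄' (hsol h𝔄).1 (hsol h𝔄').1 (hsol h𝔄).2
    (hsol h𝔄').2

/-- **ZERO DATA, ZERO SOLUTION**: `solAt 𝒢 Λ W ε₄ 0 0 = 0` under the flat hypotheses (with `j = 0`, `0 < a`) — the
flat centre of `solAt_along` read pointwise (constant families). [folklore] -/
theorem solAt_zero_zero [CompleteSpace 𝒴] (h𝒢 : ∀ f, ‖𝒢 f‖ ≤ B₀ * ‖f‖)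
    (hΛ : ∀ Y, ‖Λ Y‖ ≤ θ * ‖Y‖) (hW : Prop4Hyp W C₄ a₃) (hB₀ : 0 ≤ B₀) (hC₄ : 0 ≤ C₄) (hθ : 0 ≤ θ)
    (hε₄ : 0 ≤ ε₄) (ha : 0 < a) (hdom : 2 * (ε₄ + a) ≤ a₃)
    (hself : B₀ * 0 + θ * (ε₄ + a) + B₀ * C₄ * (ε₄ + a) ^ 2 ≤ ε₄) (hcontr : θ + 4 * B₀ * C₄ * (ε₄ + a) < 1) :
    solAt 𝒢 Λ W ε₄ (0 : 𝒵) (0 : 𝒴) = 0 :=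
  (solAt_along h𝒢 hΛ hW hB₀ hC₄ hθ hε₄ hdom hself hcontr zero_lt_one (Jf := fun _ => (0 : 𝒵))
    (𝔄f := fun _ => (0 : 𝒴)) (differentiableOn_const _) (differentiableOn_const _)
    (fun _ _ => by simp) (fun _ _ => by simpa using ha) rfl rfl).2.2

end Scheme

/-! ## §3 The Landau correction and the Landau exponent read in a second norm -/

section Landau

variable (π𝒴 : 𝒴 →L[ℂ] P𝒴) (π𝒴' : 𝒴' →L[ℂ] P𝒴') (π𝒳 : 𝒳 →L[ℂ] P𝒳)
  {C : 𝒴' → 𝒳} {ι : 𝒴 →L[ℂ] 𝒴'} {H : 𝒳 →L[ℂ] 𝒴} {R LC cι BH : ℝ}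

/-- **THE FIXED POINTS OF (50) READ IN A SECOND NORM.**  Pinned binders: `hCp` (`C` is `L_C`-Lipschitz through the
readings on the flat ball `‖·‖ < R`), `hιp`, `hHp` (pinned operator bounds of the scaling `ι` and of `H`),
`k := L_C·c_ι·B_H < 1`.  For two FLAT fixed points `D = C(ι Y − ι H D)`, `D′ = C(ι Y′ − ι H D′)` whose three relevant
arguments lie in the flat ball `‖·‖ < R`:  `‖π𝒳 D − π𝒳 D′‖ ≤ L_C c_ι∕(1−k)·‖π𝒴 Y − π𝒴 Y′‖` and, for the Landau
exponents `Y − H D`, `‖π𝒴(Y − H D) − π𝒴(Y′ − H D′)‖ ≤ 1∕(1−k)·‖π𝒴 Y − π𝒴 Y′‖`. [folklore] -/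
theorem norm_sub_le_of_corr_fixedPoints
    (hCp : ∀ A A' : 𝒴', ‖A‖ < R → ‖A'‖ < R → ‖π𝒳 (C A) - π𝒳 (C A')‖ ≤ LC * ‖π𝒴' A - π𝒴' A'‖)
    (hιp : ∀ Y, ‖π𝒴' (ι Y)‖ ≤ cι * ‖π𝒴 Y‖) (hHp : ∀ X, ‖π𝒴 (H X)‖ ≤ BH * ‖π𝒳 X‖)
    (hLC : 0 ≤ LC) (hcι : 0 ≤ cι) (hBH : 0 ≤ BH) (hk : LC * cι * BH < 1)
    {Y Y' : 𝒴} {D D' : 𝒳} (hfix : C (ι Y - ι (H D)) = D) (hfix' : C (ι Y' - ι (H D')) = D')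
    (hR : ‖ι Y - ι (H D)‖ < R) (hRm : ‖ι Y - ι (H D')‖ < R) (hR' : ‖ι Y' - ι (H D')‖ < R) :
    ‖π𝒳 D - π𝒳 D'‖ ≤ LC * cι / (1 - LC * cι * BH) * ‖π𝒴 Y - π𝒴 Y'‖ ∧
      ‖π𝒴 (Y - H D) - π𝒴 (Y' - H D')‖ ≤ 1 / (1 - LC * cι * BH) * ‖π𝒴 Y - π𝒴 Y'‖ := by
  -- the transformation at `Y` contracts through `π𝒳` with `k`
  have hcontr : ‖π𝒳 (C (ι Y - ι (H D))) - π𝒳 (C (ι Y - ι (H D')))‖ ≤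
      LC * cι * BH * ‖π𝒳 D - π𝒳 D'‖ := by
    have e : π𝒴' (ι Y - ι (H D)) - π𝒴' (ι Y - ι (H D')) = -(π𝒴' (ι (H (D - D')))) := by
      simp only [map_sub]; abel
    calc ‖π𝒳 (C (ι Y - ι (H D))) - π𝒳 (C (ι Y - ι (H D')))‖
        ≤ LC * ‖π𝒴' (ι Y - ι (H D)) - π𝒴' (ι Y - ι (H D'))‖ := hCp _ _ hR hRm
      _ = LC * ‖π𝒴' (ι (H (D - D')))‖ := by rw [e, norm_neg]
      _ ≤ LC * (cι * (BH * ‖π𝒳 (D - D')‖)) :=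
          mul_le_mul_of_nonneg_left ((hιp _).trans (mul_le_mul_of_nonneg_left (hHp _) hcι)) hLC
      _ = LC * cι * BH * ‖π𝒳 D - π𝒳 D'‖ := by rw [map_sub]; ring
  -- the transformations at `Y` and `Y′` differ by `L_C c_ι‖π𝒴 Y − π𝒴 Y′‖` at `D′`
  have hη : ‖π𝒳 (C (ι Y - ι (H D'))) - π𝒳 (C (ι Y' - ι (H D')))‖ ≤ LC * cι * ‖π𝒴 Y - π𝒴 Y'‖ := by
    have e : π𝒴' (ι Y - ι (H D')) - π𝒴' (ι Y' - ι (H D')) = π𝒴' (ι (Y - Y')) := by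
      simp only [map_sub]; abel
    calc ‖π𝒳 (C (ι Y - ι (H D'))) - π𝒳 (C (ι Y' - ι (H D')))‖
        ≤ LC * ‖π𝒴' (ι Y - ι (H D')) - π𝒴' (ι Y' - ι (H D'))‖ := hCp _ _ hRm hR'
      _ ≤ LC * (cι * ‖π𝒴 (Y - Y')‖) := by rw [e]; exact mul_le_mul_of_nonneg_left (hιp _) hLC
      _ = LC * cι * ‖π𝒴 Y - π𝒴 Y'‖ := by rw [map_sub]; ring
  have h1 : ‖π𝒳 D - π𝒳 D'‖ ≤ LC * cι / (1 - LC * cι * BH) * ‖π𝒴 Y - π𝒴 Y'‖ := by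
    have h := norm_sub_le_of_fixedPoints π𝒳 (T := fun X => C (ι Y - ι (H X)))
      (T' := fun X => C (ι Y' - ι (H X))) hfix hfix' hk hcontr hη
    rwa [mul_div_right_comm] at h
  refine ⟨h1, ?_⟩
  calc ‖π𝒴 (Y - H D) - π𝒴 (Y' - H D')‖ = ‖(π𝒴 Y - π𝒴 Y') - π𝒴 (H (D - D'))‖ := by
        simp only [map_sub]; congr 1; abel
    _ ≤ ‖π𝒴 Y - π𝒴 Y'‖ + ‖π𝒴 (H (D - D'))‖ := norm_sub_le _ _
    _ ≤ ‖π𝒴 Y - π𝒴 Y'‖ + BH * (LC * cι / (1 - LC * cι * BH) * ‖π𝒴 Y - π𝒴 Y'‖) := by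
        refine add_le_add le_rfl ((hHp _).trans (mul_le_mul_of_nonneg_left ?_ hBH))
        rwa [map_sub]
    _ = LC * cι * BH / (1 - LC * cι * BH) * ‖π𝒴 Y - π𝒴 Y'‖ + ‖π𝒴 Y - π𝒴 Y'‖ := by ring
    _ = 1 / (1 - LC * cι * BH) * ‖π𝒴 Y - π𝒴 Y'‖ := aux_geom hk

variable {C₂ B₀ ε : ℝ}

/-- the arguments of (50) stay in the flat ball: `‖Y‖ < ε`, `‖X‖ ≤ 4C₂ε²`, `‖ι ·‖ ≤ ‖·‖`, `‖H X‖ ≤ B₀‖X‖`,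
`9C₂B₀ε < 1` (so `4C₂B₀ε ≤ 1`: if `4x > 1` then `9x > 1`), `3ε ≤ R` ⟹ `‖ι Y − ι(H X)‖ < R` (the located form of Sect. C's «2ε₃»). [folklore] -/
theorem norm_arg_lt_of_mem (hι : ∀ Y, ‖ι Y‖ ≤ ‖Y‖) (hB₀ : 0 ≤ B₀)
    (hH : ∀ X, ‖H X‖ ≤ B₀ * ‖X‖) (hq : 9 * C₂ * B₀ * ε < 1) (hRC : 3 * ε ≤ R) {Y : 𝒴} (hY : ‖Y‖ < ε)
    {X : 𝒳} (hX : ‖X‖ ≤ 4 * C₂ * ε ^ 2) : ‖ι Y - ι (H X)‖ < R := by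
  have hε : 0 < ε := (norm_nonneg _).trans_lt hY
  have hR2 : 4 * C₂ * B₀ * ε ≤ 1 := by linarith
  have hHX : ‖ι (H X)‖ ≤ ε :=
    calc ‖ι (H X)‖ ≤ B₀ * ‖X‖ := (hι _).trans (hH X)
      _ ≤ B₀ * (4 * C₂ * ε ^ 2) := mul_le_mul_of_nonneg_left hX hB₀
      _ = (4 * C₂ * B₀ * ε) * ε := by ring
      _ ≤ 1 * ε := mul_le_mul_of_nonneg_right hR2 hε.le
      _ = ε := one_mul ε
  calc ‖ι Y - ι (H X)‖ ≤ ‖ι Y‖ + ‖ι (H X)‖ := norm_sub_le _ _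
    _ < ε + ε := add_lt_add_of_lt_of_le ((hι _).trans_lt hY) hHX
    _ ≤ R := by linarith

/-- **`corrAt` AND `landauExp` READ IN A SECOND NORM.**  Under Sect. C's FLAT list VERBATIM from
`ShellMeasureLandauHolonomy.corrAt_along` ((44)+[4] Prop. 7 `hCq`∕`hCd` on `ball 0 R`; the scaling `hι`; (46) `hH`;
the (54)-smallness `9C₂B₀ε < 1`; `3ε ≤ R`) — so that `corrAt C ι H (4C₂ε²) Y` IS the unique fixed point of (50) in the
closed ball `4C₂ε²` (`B13Contraction113.exists_unique_fixedPoint`) — and the pinned binders of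
`norm_sub_le_of_corr_fixedPoints`: for `‖Y‖, ‖Y′‖ < ε`,
`‖π𝒳(corrAt … Y) − π𝒳(corrAt … Y′)‖ ≤ L_C c_ι∕(1−k)·‖π𝒴 Y − π𝒴 Y′‖` and
`‖π𝒴(landauExp … Y) − π𝒴(landauExp … Y′)‖ ≤ 1∕(1−k)·‖π𝒴 Y − π𝒴 Y′‖`. [folklore] -/
theorem norm_sub_corrAt_le [CompleteSpace 𝒳] (hC₂ : 0 ≤ C₂)
    (hCq : ∀ Z : 𝒴', ‖Z‖ < R → ‖C Z‖ ≤ C₂ * ‖Z‖ ^ 2) (hCd : DifferentiableOn ℂ C (ball 0 R))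
    (hι : ∀ Y, ‖ι Y‖ ≤ ‖Y‖) (hB₀ : 0 ≤ B₀) (hH : ∀ X, ‖H X‖ ≤ B₀ * ‖X‖) (hq : 9 * C₂ * B₀ * ε < 1)
    (hRC : 3 * ε ≤ R)
    (hCp : ∀ A A' : 𝒴', ‖A‖ < R → ‖A'‖ < R → ‖π𝒳 (C A) - π𝒳 (C A')‖ ≤ LC * ‖π𝒴' A - π𝒴' A'‖)
    (hιp : ∀ Y, ‖π𝒴' (ι Y)‖ ≤ cι * ‖π𝒴 Y‖) (hHp : ∀ X, ‖π𝒴 (H X)‖ ≤ BH * ‖π𝒳 X‖)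
    (hLC : 0 ≤ LC) (hcι : 0 ≤ cι) (hBH : 0 ≤ BH) (hk : LC * cι * BH < 1)
    {Y Y' : 𝒴} (hY : ‖Y‖ < ε) (hY' : ‖Y'‖ < ε) :
    ‖π𝒳 (corrAt C ι H (4 * C₂ * ε ^ 2) Y) - π𝒳 (corrAt C ι H (4 * C₂ * ε ^ 2) Y')‖ ≤
        LC * cι / (1 - LC * cι * BH) * ‖π𝒴 Y - π𝒴 Y'‖ ∧
      ‖π𝒴 (landauExp C ι H (4 * C₂ * ε ^ 2) Y) - π𝒴 (landauExp C ι H (4 * C₂ * ε ^ 2) Y')‖ ≤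
        1 / (1 - LC * cι * BH) * ‖π𝒴 Y - π𝒴 Y'‖ := by
  have hHop : ∀ X : 𝒳, ‖((ι.comp H : 𝒳 →L[ℂ] 𝒴') : 𝒳 →ₗ[ℂ] 𝒴') X‖ ≤ B₀ * ‖X‖ :=
    fun X => (hι _).trans (hH X)
  have hcorr : ∀ {Y₀ : 𝒴}, ‖Y₀‖ < ε →
      corrAt C ι H (4 * C₂ * ε ^ 2) Y₀ ∈ closedBall (0 : 𝒳) (4 * C₂ * ε ^ 2) ∧
        C (ι Y₀ - ι (H (corrAt C ι H (4 * C₂ * ε ^ 2) Y₀))) = corrAt C ι H (4 * C₂ * ε ^ 2) Y₀ := by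
    intro Y₀ hY₀
    obtain ⟨X, hX, hfix, -⟩ := exists_unique_fixedPoint (quadAnalytic_of_frechet hCq hCd) hC₂ hB₀ hHop
      ((hι Y₀).trans_lt hY₀) hq hRC
    exact corrAt_spec ⟨X, hX, hfix⟩
  have hD := hcorr hY
  have hD' := hcorr hY'
  rw [landauExp_apply, landauExp_apply]
  exact norm_sub_le_of_corr_fixedPoints π𝒴 π𝒴' π𝒳 hCp hιp hHp hLC hcι hBH hk hD.2 hD'.2
    (norm_arg_lt_of_mem hι hB₀ hH hq hRC hY (mem_closedBall_zero_iff.1 hD.1))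
    (norm_arg_lt_of_mem hι hB₀ hH hq hRC hY (mem_closedBall_zero_iff.1 hD'.1))
    (norm_arg_lt_of_mem hι hB₀ hH hq hRC hY' (mem_closedBall_zero_iff.1 hD'.1))

/-- **ZERO FIELD, ZERO CORRECTION**: `corrAt C ι H (4C₂ε²) 0 = 0` for `0 < ε` under Sect. C's flat list — (55)
`‖D‖ ≤ 4C₂‖ι Y‖²` at `Y = 0` (`corrAt_along` on the constant curve). [folklore] -/
theorem corrAt_zero [CompleteSpace 𝒳] (hC₂ : 0 ≤ C₂)
    (hCq : ∀ Z : 𝒴', ‖Z‖ < R → ‖C Z‖ ≤ C₂ * ‖Z‖ ^ 2) (hCd : DifferentiableOn ℂ C (ball 0 R))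
    (hι : ∀ Y, ‖ι Y‖ ≤ ‖Y‖) (hB₀ : 0 ≤ B₀) (hH : ∀ X, ‖H X‖ ≤ B₀ * ‖X‖) (hq : 9 * C₂ * B₀ * ε < 1)
    (hRC : 3 * ε ≤ R) (hε : 0 < ε) : corrAt C ι H (4 * C₂ * ε ^ 2) (0 : 𝒴) = 0 := by
  have h := (corrAt_along hC₂ hCq hCd ι hι H hB₀ hH hq hRC (Rad := 1) (Y := fun _ => (0 : 𝒴))
    (differentiableOn_const _) (fun _ _ => by simpa using hε)).2 0 (mem_ball_self zero_lt_one)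
  have hb : ‖corrAt C ι H (4 * C₂ * ε ^ 2) (0 : 𝒴)‖ ≤ 4 * C₂ * ‖ι (0 : 𝒴)‖ ^ 2 := h.2.2.2
  rw [map_zero, norm_zero] at hb
  exact norm_le_zero_iff.1 (by simpa using hb)

/-- … hence `landauExp C ι H (4C₂ε²) 0 = 0`. [folklore] -/
theorem landauExp_zero [CompleteSpace 𝒳] (hC₂ : 0 ≤ C₂) (hCq : ∀ Z : 𝒴', ‖Z‖ < R → ‖C Z‖ ≤ C₂ * ‖Z‖ ^ 2) (hCd : DifferentiableOn ℂ C (ball 0 R))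
    (hι : ∀ Y, ‖ι Y‖ ≤ ‖Y‖) (hB₀ : 0 ≤ B₀) (hH : ∀ X, ‖H X‖ ≤ B₀ * ‖X‖) (hq : 9 * C₂ * B₀ * ε < 1)
    (hRC : 3 * ε ≤ R) (hε : 0 < ε) : landauExp C ι H (4 * C₂ * ε ^ 2) (0 : 𝒴) = 0 := by
  rw [landauExp_apply, corrAt_zero hC₂ hCq hCd hι hB₀ hH hq hRC hε, map_zero, sub_zero]

end Landau

/-! ## §4 How a pinned Lipschitz binder is produced: conjugated derivative bound ⟹ Lipschitz through the readings -/

/-- **CONJUGATED DERIVATIVE BOUND ⟹ PINNED LIPSCHITZ BOUND.**  Readings that are continuous linear EQUIVALENCES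
`e_E : E ≃L[ℂ] P_E`, `e_F : F ≃L[ℂ] P_F` (on the finite lattice: the identity between the flat and the pinned norm,
S65 f2a `WSup.toPiL`), a map `G` ℂ-differentiable on an OPEN CONVEX flat set `s`, and a bound `q` on the operator
norm of the conjugated derivative `e_F ∘L DG(x) ∘L e_E⁻¹ : P_E →L P_F` on `s` (for a decaying kernel: S69 (A)
`ShellMeasurePinnedNorm.opNorm_kerOpPin_le`) ⟹ `‖e_F(G x) − e_F(G y)‖ ≤ q·‖e_E x − e_E y‖` for `x, y ∈ s` — the shape
of §2's `hGWp` and §3's `hCp` (Mathlib's mean value inequality `Convex.norm_image_sub_le_of_norm_fderiv_le` run in the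
pinned space on the conjugated map over the conjugated set). [folklore] -/
theorem norm_sub_le_of_conj_fderiv_le {E F PE PF : Type*} [NormedAddCommGroup E] [NormedSpace ℂ E]
    [NormedAddCommGroup F] [NormedSpace ℂ F] [NormedAddCommGroup PE] [NormedSpace ℂ PE]
    [NormedAddCommGroup PF] [NormedSpace ℂ PF] (eE : E ≃L[ℂ] PE) (eF : F ≃L[ℂ] PF)
    {G : E → F} {s : Set E} (hs : Convex ℝ s) (hso : IsOpen s) (hG : DifferentiableOn ℂ G s) {q : ℝ}
    (hq : ∀ x ∈ s, ‖(eF : F →L[ℂ] PF).comp ((fderiv ℂ G x).comp (eE.symm : PE →L[ℂ] E))‖ ≤ q)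
    {x y : E} (hx : x ∈ s) (hy : y ∈ s) :
    ‖eF (G x) - eF (G y)‖ ≤ q * ‖eE x - eE y‖ := by
  -- the conjugated set is convex (linear preimage) and open
  have hs' : Convex ℝ ((eE.symm : PE → E) ⁻¹' s) :=
    hs.linear_preimage (((eE.symm : PE →L[ℂ] E).restrictScalars ℝ : PE →L[ℝ] E) : PE →ₗ[ℝ] E)
  have hmem : ∀ {z : E}, z ∈ s → eE z ∈ (eE.symm : PE → E) ⁻¹' s := fun hz => by
    simpa only [mem_preimage, ContinuousLinearEquiv.symm_apply_apply] using hz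
  have hGd : ∀ p ∈ (eE.symm : PE → E) ⁻¹' s, DifferentiableAt ℂ G (eE.symm p) := fun p hp =>
    (hG _ hp).differentiableAt (hso.mem_nhds hp)
  -- the conjugated map is differentiable there, with the conjugated derivative
  have hdiff : ∀ p ∈ (eE.symm : PE → E) ⁻¹' s,
      DifferentiableAt ℂ ((eF : F → PF) ∘ (G ∘ (eE.symm : PE → E))) p := fun p hp =>
    eF.differentiableAt.comp p ((hGd p hp).comp p eE.symm.differentiableAt)
  have hbound : ∀ p ∈ (eE.symm : PE → E) ⁻¹' s,
      ‖fderiv ℂ ((eF : F → PF) ∘ (G ∘ (eE.symm : PE → E))) p‖ ≤ q := by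
    intro p hp
    rw [eF.comp_fderiv, eE.symm.comp_right_fderiv]
    exact hq _ hp
  have h := hs'.norm_image_sub_le_of_norm_fderiv_le (𝕜 := ℂ) hdiff hbound (hmem hy) (hmem hx)
  simpa only [Function.comp_apply, ContinuousLinearEquiv.symm_apply_apply] using h

end Summit.QuantumFields.BalabanUV.T4Continuum.ShellMeasureLandauPinnedFixedPoint

end
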